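import Summits.Ventures.PercRepro.Night2NonFatLevelAny
import Summits.Ventures.PercRepro.Night2BasisLoadedC

/-!
# night-2: the NON-FAT case of (FAIR) — a loaded level-2 target contains three collinear points (gen 37)

A loaded target (`dload ≠ 0`) is a good target `Q_b ∪ {x}` of a lossy big pair, or a distance-2 target `Q_b ∪ {x, x′}` of one
without good points (g32, `exists_pair_of_dload_ne_zero'`), and `Q_b ∖ K` has at least six points.  At level 2 (`|T ∖ K| = 7`)
only the first kind fits, with `|Q_b ∖ K| = 6` exactly, and `Q_b ∖ K` contains a rank-`2` set of three points
(`exists_rank_two_of_loss_ne_zero`): **`exists_collinear_of_dload_ne_zero_seven`**.  For the level-2 target `Q ∪ {y, y′}` of a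
basis pair the three collinear points are not all in the independent basis `Q′`, so they involve `y` or `y′`
(**`exists_collinear_mem_insert_of_dload_ne_zero`**): a level-2 target is unloaded unless `y` or `y′` lies on a line through two
other points of `Q′ ∪ {y, y′}` — the collinear-triple structure of the loaded targets (paper g36 §5, g32 §2.3).
Paper: proofs/NIGHT-2-g37.md §6.
-/

namespace PercRepro.Shadow

open PercRepro.ThmH PercRepro.PerFlat

variable {α : Type*} [DecidableEq α] {M : Matroid α} [M.Finite] {G : Finset α}

/-- **A loaded target with seven points off `K` contains three collinear points.** -/
theorem exists_collinear_of_dload_ne_zero_seven (hG : G ∈ flatsQ M (5 + 1)) (hd : (gr M \ G).card = 2)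
    (hk : kColoops M G = 1) (hs : ∀ e ∈ gr M, ∀ f ∈ gr M, e ≠ f → rkN M {e, f} = 2)
    (hl : ∀ e ∈ gr M, M.Indep {e}) (hfat : (fatClosures M 5 G 2).card ≤ 1) {T : Finset α}
    (h7 : (T \ coloops M G).card = 7) (hne : dload M 5 G (bigP M G) (dshGT2 M 5 G) T ≠ 0) :
    ∃ R ⊆ T \ coloops M G, R.card = 3 ∧ rkN M R = 2 := by
  have hd' : (gr M \ G).card ≤ 5 := by omega
  obtain ⟨B, hB, hbig, z, hz, hloss, hcase⟩ := exists_pair_of_dload_ne_zero' hG hd hk hs hl hfat hne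
  have hKB : coloops M G ⊆ B := coloops_subset_of_mem_thinMembers hG hd' hB
  have hBG : B ⊆ G := subset_G_of_mem_thinMembers hB
  have hGg : G ⊆ gr M := (mem_flatsQ.1 hG).1
  have hzB : z ∉ B := fun h => (Finset.mem_sdiff.1 hz).2 (subset_clF_of_subset_gr (hBG.trans hGg) h)
  have hzK : z ∉ coloops M G := fun h => hzB (hKB h)
  have hQ'6 : 6 ≤ (insert z B \ coloops M G).card := by
    rw [insert_sdiff_coloops_eq hzK, Finset.card_insert_of_notMem (fun h => hzB (Finset.mem_sdiff.1 h).1)]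
    omega
  obtain ⟨R, hRQ, hR2, hRcard⟩ := exists_rank_two_of_loss_ne_zero hG hd hk hs hl hB hbig hz hloss
  rcases hcase with ⟨-, x, hx, rfl⟩ | ⟨-, p, hp, rfl⟩
  · -- a good target: `T ∖ K = insert x (Q_b ∖ K)`, seven points, so `|Q_b ∖ K| = 6` and `|R| = 3`
    have hxQ : x ∉ insert z B := notMem_of_mem_goodPts hx
    have hxK : x ∉ coloops M G := fun h => hxQ (Finset.mem_insert_of_mem (hKB h))
    rw [insert_sdiff_coloops_eq hxK, Finset.card_insert_of_notMem (fun h => hxQ (Finset.mem_sdiff.1 h).1)] at h7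
    refine ⟨R, hRQ.trans ?_, by omega, hR2⟩
    rw [insert_sdiff_coloops_eq hxK]
    exact Finset.subset_insert _ _
  · -- a distance-2 target has at least eight points off `K`
    exfalso
    rw [mem_d2Pts] at hp
    obtain ⟨⟨hp1, hp2⟩, hp12, -⟩ := hp
    have hp1Q : p.1 ∉ insert z B := (Finset.mem_sdiff.1 hp1).2
    have hp2Q : p.2 ∉ insert z B := (Finset.mem_sdiff.1 hp2).2
    have hp1K : p.1 ∉ coloops M G := fun h => hp1Q (Finset.mem_insert_of_mem (hKB h))
    have hp2K : p.2 ∉ coloops M G := fun h => hp2Q (Finset.mem_insert_of_mem (hKB h))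
    rw [insert_sdiff_coloops_eq hp1K, insert_sdiff_coloops_eq hp2K,
      Finset.card_insert_of_notMem, Finset.card_insert_of_notMem (fun h => hp2Q (Finset.mem_sdiff.1 h).1)] at h7
    · omega
    · intro h
      rw [Finset.mem_insert, Finset.mem_sdiff] at h
      rcases h with h | h
      · exact hp12 h
      · exact hp1Q h.1

/-- **A loaded level-2 target of a basis pair has three collinear points involving `y` or `y′`**: three collinear points of
`Q′ ∪ {y, y′}` are not all in the independent set `Q′`. -/
theorem exists_collinear_mem_insert_of_dload_ne_zero (hG : G ∈ flatsQ M (5 + 1)) (hd : (gr M \ G).card = 2)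
    (hk : kColoops M G = 1) (hs : ∀ e ∈ gr M, ∀ f ∈ gr M, e ≠ f → rkN M {e, f} = 2)
    (hl : ∀ e ∈ gr M, M.Indep {e}) (hfat : (fatClosures M 5 G 2).card ≤ 1) {B : Finset α}
    (hB : B ∈ thinMembers M 5 G) (hnP : ¬ bigP M G B) {z : α} (hz : z ∈ G \ clF M B) {y y' : α}
    (hy : y ∈ G \ insert z B) (hy' : y' ∈ G \ insert z B) (hyy : y ≠ y')
    (hne : dload M 5 G (bigP M G) (dshGT2 M 5 G) (insert y (insert y' (insert z B))) ≠ 0) :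
    ∃ R ⊆ insert y (insert y' (insert z B)) \ coloops M G, R.card = 3 ∧ rkN M R = 2 ∧ (y ∈ R ∨ y' ∈ R) := by
  have hd' : (gr M \ G).card ≤ 5 := by omega
  have hKB : coloops M G ⊆ B := coloops_subset_of_mem_thinMembers hG hd' hB
  have hyQ : y ∉ insert z B := (Finset.mem_sdiff.1 hy).2
  have hy'Q : y' ∉ insert z B := (Finset.mem_sdiff.1 hy').2
  have hyK : y ∉ coloops M G := fun h => hyQ (Finset.mem_insert_of_mem (hKB h))
  have hy'K : y' ∉ coloops M G := fun h => hy'Q (Finset.mem_insert_of_mem (hKB h))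
  have h7 : (insert y (insert y' (insert z B)) \ coloops M G).card = 7 := by
    rw [insert_sdiff_coloops_eq hyK, Finset.card_insert_of_notMem, card_insert_sdiff_coloops_eq_six hG hd hk hB hnP hz hy']
    intro h
    rw [Finset.mem_sdiff, Finset.mem_insert] at h
    rcases h.1 with h1 | h1
    · exact hyy h1
    · exact hyQ h1
  obtain ⟨R, hRT, hR3, hR2⟩ := exists_collinear_of_dload_ne_zero_seven hG hd hk hs hl hfat h7 hne
  refine ⟨R, hRT, hR3, hR2, ?_⟩
  by_contra hnot
  push Not at hnot
  -- `R ⊆ Q′` would be a three-point subset of an independent set of rank `2`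
  have hRQ : R ⊆ insert z B \ coloops M G := by
    intro e he
    have := hRT he
    rw [insert_sdiff_coloops_eq hyK, insert_sdiff_coloops_eq hy'K, Finset.mem_insert, Finset.mem_insert] at this
    rcases this with rfl | rfl | h
    · exact absurd he hnot.1
    · exact absurd he hnot.2
    · exact h
  have hQ'rk : rkN M (insert z B \ coloops M G) = (insert z B \ coloops M G).card :=
    rkN_eq_card_of_subset_of_rkN_eq_card (rkN_insert_eq_card hG hd hk hB hnP hz) Finset.sdiff_subset
  have := rkN_eq_card_of_subset_of_rkN_eq_card hQ'rk hRQ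
  omega

end PercRepro.Shadow
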